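import Summits.CriticalPhenomena.Ising3DConformalLimit.Theorems.AnomalousForcesInteractionEtaPositiveSusceptibilityForm
import Mathlib.Analysis.PSeries
import HarnessLib

/-!
# Crux `EtaPositive` (stmt-CriticalPhenomena-2600): the Dirichlet-abscissa currency

Support file for crux `EtaPositive := ∃ κ > 0, C, ∀ x ≠ 0, G(x) ≤ C ‖x‖^{-(1+κ)}` of route
`AnomalousForcesInteraction` (sub-problem `Ising3DConformalLimit`), `G(x) = ⟨σ₀σ_x⟩⁺_{β_c(3),0}`
(`criticalTwoPoint 3`, sup norm on `ℤ³`), `G_m := G(m e₁)` the antitone (Messager–Miracle-Solé) axis sequence.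

* `EtaPositive_iff_axis_moment_summable` — `EtaPositive ⟺ ∃ s > 0, Σ_m m^s G_m < ∞`.

So the crux says exactly that the ABSCISSA OF CONVERGENCE `η_* := sup {s : Σ_m m^s G_m < ∞}` of the Dirichlet
series of the axis two-point function is positive. `η_*` is always defined — no existence of an exponent
(item stmt-CriticalPhenomena-0635) is presupposed — and `0 ≤ η_* ≤ 1` by the tree's window
`c m^{-2} ≤ G_m ≤ C m^{-1}` (`criticalTwoPoint_bounds_holds`); if the logarithmic exponent `η` of
`HasIsingExponentEta 3 η` exists then `η_* = η`, and in general `η_*` is the lim inf exponent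
`liminf_m (-log G_m / log m) - 1`, whereas the i.o. child `EtaGainIO` (`…SplitGlue`) is the statement
`limsup_m (-log G_m / log m) - 1 > 0`. Forward direction: compare with `Σ m^{-1-κ/2}`; backward: antitonicity
and condensation over the blocks `[m, 2m)`: `m · m^s G_{2m} ≤ Σ_{m ≤ j < 2m} j^s G_j ≤ Σ_j j^s G_j`, then
`G_n ≤ G_{2⌊n/2⌋}` and `⌊n/2⌋ ≥ n/3`.

Unconditional bookkeeping about the nearest-neighbour Ising model on `ℤ³` (standard axioms, no named fact);
tree inputs: `criticalTwoPoint_axis_antitone`, `EtaPositive_iff_axis_gain` (p165244), `Real.summable_nat_rpow`.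
-/

noncomputable section

namespace Summit.CriticalPhenomena.Ising3DConformalLimit.AnomalousForcesInteractionEtaPositive

open Finset Literature.Probability.LatticeModels

/-- **`η(3) > 0` in power form ⟺ a positive moment of the axis two-point function is summable.** The crux
`EtaPositive` is equivalent to: `Σ_m m^s ⟨σ₀σ_{m e₁}⟩⁺_{β_c(3)} < ∞` for SOME `s > 0`. Equivalently, the abscissa
of convergence `η_* := sup {s : Σ_m m^s G(m e₁) < ∞}` of the Dirichlet series of the axis two-point function —
always defined, with `0 ≤ η_* ≤ 1` from the window `c m^{-2} ≤ G(m e₁) ≤ C m^{-1}` — is POSITIVE. Forward: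
compare with `Σ m^{-1-κ/2}`; backward: Messager–Miracle-Solé antitonicity and condensation over the blocks
`[m, 2m)`: `m · m^s G(2m e₁) ≤ Σ_{m ≤ j < 2m} j^s G(j e₁) ≤ Σ_j j^s G(j e₁)`. -/
theorem EtaPositive_iff_axis_moment_summable : Summit.CriticalPhenomena.Ising3DConformalLimit.Theses.AnomalousForcesInteraction.EtaPositive ↔ ∃ s : ℝ, 0 < s ∧ Summable (fun m : ℕ => (m : ℝ) ^ s * Literature.Probability.LatticeModels.criticalTwoPoint 3 (Pi.single 0 (m : ℤ))) := by
  have hG0 : ∀ y : Site 3, 0 ≤ criticalTwoPoint 3 y := fun y =>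
    twoPointPlus_nonneg_of_gks (criticalBeta_nonneg 3) y
  constructor
  · rw [EtaPositive_iff_axis_gain]
    rintro ⟨κ, C, hκ, h⟩
    refine ⟨κ / 2, by positivity, ?_⟩
    set C' : ℝ := max C 0 with hC'def
    have hC'0 : 0 ≤ C' := le_max_right _ _
    have hbound : ∀ m : ℕ, (m : ℝ) ^ (κ / 2) * criticalTwoPoint 3 (Pi.single 0 (m : ℤ)) ≤
        C' * (m : ℝ) ^ (-(1 + κ / 2)) := by
      intro m
      rcases Nat.eq_zero_or_pos m with rfl | hm
      · have h0 : ((0 : ℕ) : ℝ) ^ (κ / 2) = 0 := by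
          rw [Nat.cast_zero, Real.zero_rpow (by positivity : κ / 2 ≠ 0)]
        have h0' : ((0 : ℕ) : ℝ) ^ (-(1 + κ / 2)) = 0 := by
          rw [Nat.cast_zero, Real.zero_rpow (by linarith : -(1 + κ / 2) ≠ 0)]
        rw [h0, h0', zero_mul, mul_zero]
      · have hm0 : (0 : ℝ) < m := by exact_mod_cast hm
        have hp0 : 0 ≤ (m : ℝ) ^ (κ / 2) := Real.rpow_nonneg hm0.le _
        have ht0 : 0 ≤ (m : ℝ) ^ (-(1 + κ)) := Real.rpow_nonneg hm0.le _
        calc (m : ℝ) ^ (κ / 2) * criticalTwoPoint 3 (Pi.single 0 (m : ℤ))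
            ≤ (m : ℝ) ^ (κ / 2) * (C * (m : ℝ) ^ (-(1 + κ))) := mul_le_mul_of_nonneg_left (h m hm) hp0
          _ ≤ (m : ℝ) ^ (κ / 2) * (C' * (m : ℝ) ^ (-(1 + κ))) :=
              mul_le_mul_of_nonneg_left (mul_le_mul_of_nonneg_right (le_max_left _ _) ht0) hp0
          _ = C' * ((m : ℝ) ^ (κ / 2) * (m : ℝ) ^ (-(1 + κ))) := by ring
          _ = C' * (m : ℝ) ^ (-(1 + κ / 2)) := by
              rw [← Real.rpow_add hm0]; congr 1; ring_nf
    have hsum : Summable (fun m : ℕ => C' * (m : ℝ) ^ (-(1 + κ / 2))) :=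
      (Real.summable_nat_rpow.2 (by linarith)).mul_left C'
    refine Summable.of_nonneg_of_le (fun m => ?_) hbound hsum
    exact mul_nonneg (Real.rpow_nonneg (Nat.cast_nonneg _) _) (hG0 _)
  · rintro ⟨s, hs, hsum⟩
    rw [EtaPositive_iff_axis_gain]
    set f : ℕ → ℝ := fun m => (m : ℝ) ^ s * criticalTwoPoint 3 (Pi.single 0 (m : ℤ)) with hfdef
    have hf0 : ∀ m, 0 ≤ f m := fun m => mul_nonneg (Real.rpow_nonneg (Nat.cast_nonneg _) _) (hG0 _)
    set S : ℝ := ∑' m, f m with hSdef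
    have hS0 : 0 ≤ S := tsum_nonneg hf0
    -- condensation over the block `[m, 2m)`: `m^{1+s} G(2m e₁) ≤ S`
    have hblock : ∀ m : ℕ, 1 ≤ m →
        (m : ℝ) ^ (1 + s) * criticalTwoPoint 3 (Pi.single 0 ((2 * m : ℕ) : ℤ)) ≤ S := by
      intro m hm
      have hm0 : (0 : ℝ) < m := by exact_mod_cast hm
      have h1 : ∑ j ∈ Finset.Ico m (2 * m), f j ≤ S := hsum.sum_le_tsum _ (fun j _ => hf0 j)
      have h2 : ∀ j ∈ Finset.Ico m (2 * m),
          (m : ℝ) ^ s * criticalTwoPoint 3 (Pi.single 0 ((2 * m : ℕ) : ℤ)) ≤ f j := by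
        intro j hj
        obtain ⟨hmj, hj2⟩ := Finset.mem_Ico.1 hj
        have hmj' : (m : ℝ) ≤ j := by exact_mod_cast hmj
        exact mul_le_mul (Real.rpow_le_rpow hm0.le hmj' hs.le) (criticalTwoPoint_axis_antitone hj2.le)
          (hG0 _) (Real.rpow_nonneg (Nat.cast_nonneg _) _)
      have h3 : ∑ _j ∈ Finset.Ico m (2 * m), (m : ℝ) ^ s * criticalTwoPoint 3 (Pi.single 0 ((2 * m : ℕ) : ℤ)) =
          (m : ℝ) * ((m : ℝ) ^ s * criticalTwoPoint 3 (Pi.single 0 ((2 * m : ℕ) : ℤ))) := by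
        rw [Finset.sum_const, Nat.card_Ico, nsmul_eq_mul]
        congr 1
        have : 2 * m - m = m := by omega
        rw [this]
      have h4 : (m : ℝ) ^ (1 + s) = (m : ℝ) * (m : ℝ) ^ s := by
        rw [Real.rpow_add hm0, Real.rpow_one]
      calc (m : ℝ) ^ (1 + s) * criticalTwoPoint 3 (Pi.single 0 ((2 * m : ℕ) : ℤ))
          = (m : ℝ) * ((m : ℝ) ^ s * criticalTwoPoint 3 (Pi.single 0 ((2 * m : ℕ) : ℤ))) := by
            rw [h4, mul_assoc]
        _ = ∑ _j ∈ Finset.Ico m (2 * m), (m : ℝ) ^ s * criticalTwoPoint 3 (Pi.single 0 ((2 * m : ℕ) : ℤ)) :=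
            h3.symm
        _ ≤ ∑ j ∈ Finset.Ico m (2 * m), f j := Finset.sum_le_sum h2
        _ ≤ S := h1
    refine ⟨s, S * (3 : ℝ) ^ (1 + s) + 1, hs, fun n hn => ?_⟩
    have hn0 : (0 : ℝ) < n := by exact_mod_cast hn
    have ht0 : 0 < (n : ℝ) ^ (-(1 + s)) := Real.rpow_pos_of_pos hn0 _
    have h3s : 0 ≤ S * (3 : ℝ) ^ (1 + s) := mul_nonneg hS0 (Real.rpow_nonneg (by norm_num) _)
    have hG1 : criticalTwoPoint 3 (Pi.single 0 (n : ℤ)) ≤ 1 :=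
      twoPointPlus_le_one_of_nonneg (criticalBeta_nonneg 3) _
    rcases Nat.lt_or_ge n 2 with hn2 | hn2
    · -- `n = 1`
      have hn1 : n = 1 := by omega
      subst hn1
      have h1 : ((1 : ℕ) : ℝ) ^ (-(1 + s)) = 1 := by rw [Nat.cast_one, Real.one_rpow]
      rw [h1, mul_one]
      linarith
    · -- `n ≥ 2`: `m = ⌊n/2⌋ ≥ 1`, `2m ≤ n ≤ 3m`
      set m : ℕ := n / 2 with hmdef
      have hm1 : 1 ≤ m := by omega
      have hm0 : (0 : ℝ) < m := by exact_mod_cast hm1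
      have h2m : 2 * m ≤ n := by omega
      have hn3m : n ≤ 3 * m := by omega
      have hanti : criticalTwoPoint 3 (Pi.single 0 (n : ℤ)) ≤
          criticalTwoPoint 3 (Pi.single 0 ((2 * m : ℕ) : ℤ)) := criticalTwoPoint_axis_antitone h2m
      have hGm : criticalTwoPoint 3 (Pi.single 0 ((2 * m : ℕ) : ℤ)) ≤ S * (m : ℝ) ^ (-(1 + s)) := by
        have hb := hblock m hm1
        have hp : 0 < (m : ℝ) ^ (1 + s) := Real.rpow_pos_of_pos hm0 _
        rw [Real.rpow_neg hm0.le, ← div_eq_mul_inv, le_div_iff₀ hp, mul_comm]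
        exact hb
      have hm3 : (m : ℝ) ^ (-(1 + s)) ≤ (3 : ℝ) ^ (1 + s) * (n : ℝ) ^ (-(1 + s)) := by
        have hnm : (n : ℝ) / 3 ≤ m := by
          rw [div_le_iff₀ (by norm_num : (0 : ℝ) < 3)]
          exact_mod_cast (show n ≤ m * 3 by omega)
        have h1 : (m : ℝ) ^ (-(1 + s)) ≤ ((n : ℝ) / 3) ^ (-(1 + s)) :=
          Real.rpow_le_rpow_of_nonpos (by positivity) hnm (by linarith)
        have h2 : ((n : ℝ) / 3) ^ (-(1 + s)) = (3 : ℝ) ^ (1 + s) * (n : ℝ) ^ (-(1 + s)) := by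
          rw [Real.div_rpow hn0.le (by norm_num), Real.rpow_neg (by norm_num : (0 : ℝ) ≤ 3),
            div_inv_eq_mul, mul_comm]
        rw [← h2]; exact h1
      calc criticalTwoPoint 3 (Pi.single 0 (n : ℤ))
          ≤ criticalTwoPoint 3 (Pi.single 0 ((2 * m : ℕ) : ℤ)) := hanti
        _ ≤ S * (m : ℝ) ^ (-(1 + s)) := hGm
        _ ≤ S * ((3 : ℝ) ^ (1 + s) * (n : ℝ) ^ (-(1 + s))) := mul_le_mul_of_nonneg_left hm3 hS0
        _ = S * (3 : ℝ) ^ (1 + s) * (n : ℝ) ^ (-(1 + s)) := by ring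
        _ ≤ (S * (3 : ℝ) ^ (1 + s) + 1) * (n : ℝ) ^ (-(1 + s)) := by nlinarith

end Summit.CriticalPhenomena.Ising3DConformalLimit.AnomalousForcesInteractionEtaPositive
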